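import Summits.QuantumFields.BalabanUV.T4Continuum.Spine.NE1p.DressedSmallFieldNestedTori
import Summits.QuantumFields.BalabanUV.T4Continuum.Support.TorusBlockRefinementCard
import Summits.QuantumFields.BalabanUV.T4Continuum.Spine.NE1p.DressedSmallFieldComponentsWitness
import Literature.MathematicalPhysics.QuantumFieldTheory.Balaban1983to89.TreeLengthTorusGeometry236

/-!
# T⁴ programme, spine estimate NE1′ (node O3b/H2) — WITNESS «THE NESTED-TORI END FIRES ON A DECIDED TWO-SCALE DATUM»: the crew's S44 END
# `DressedSmallFieldNestedTori.attachedPart_locE_le_of_coresAt_pencil_components_nestedTori` APPLIED ONCE BY NAME — a decided applier — for EVERY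
# blocking factor `3 ≤ L` and every `N′`, on the PAIR of tori `(tsys 4 N′, tsys 4 (L·N′))` with pv22's closure `tclosureDom L N′` between them

Cell `pub-balaban`, sub-cell `t4`, row NE1′ formalisation crew (`t4/formal/NE1p/LEAVES.md` row W59 ∕ DAG N29zzzi; INTENT HOME/CLAIMS.log l.21161, BOOKED typer
R-T133 (ii) at the PROTOTYPE line l.21254; X183 its read), unit `b2b-balaban-t4-ne1p-formalise-leaf-10` (gen 11).  PART 1 of 2 (D1): the datum, the closure lemma, the
clauses, the END; PART 2 `…NestedToriWitnessLive` (THEOREMS ONLY): the corner-cube leak, the label count, liveness, the `L = 3` ∕ `L = 13` examples.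
ADDITIVE — imports S44 `Spine/NE1p/DressedSmallFieldNestedTori` (leaf-01 g13; → N0w, pv22 `TreeLengthTorusGeometry236`), S47 `Support/TorusBlockRefinementCard`
(leaf-05 g11; → S43.1 `TorusBlockRefinement`), W53 `Spine/NE1p/DressedSmallFieldComponentsWitness` (leaf-10 g11; → W50.1, W45, S40.1, W41, W35, W33, W24) and pv22's
`TreeLengthTorusGeometry236` (explicit, for `a236`); toy DATA `def`s + one type `abbrev` + theorems; 0 `def … : Prop`, 0 cite, 0 sorry, 0 `attribute`; nothing of
S44 ∕ S43 ∕ S47 ∕ N0w ∕ W53 ∕ W50 ∕ W45 ∕ S40.1 ∕ W41 ∕ W35 ∕ W33 ∕ W24 ∕ pv22 ∕ b13 is restated — their declarations (`…_nestedTori`, `tclosureDom`∕`tclosure`∕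
`tcollar`∕`tblock`∕`tcoarse_proj`, `a236`, `natLift_proj_of_range`, `tFaceConnected_singleton`, `RI`, `vC`, `coveringFamilies_emptyFootprint`, `α₆F`, `link_torus'`,
`coreW`, `cM`, `budget_half`, `X₀`, `hrate_torus_num`, `Acst`, `torus_consts`, `mem_coveringFamilies`) are used BY NAME.

WHY.  Every decided witness of the crew so far (W45 … W53, 13 modules) reads ONE torus at both scales (`foot = id` ∕ `cl = id` — the typer's R5 ∕ R-T127 (e)
remarks; S47's `torusTreeLen_lt_trefine_singleton` locates the strictness a real refinement has).  S44 put N0w's END on pv22's NESTED tori with the closure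
`cl := tclosureDom L N′` (FINE domains ↦ COARSE domains — two different catalogues), the (2.36) transfer `ineq236With_torus` and the anchor `3⁴·L⁴` DISCHARGED
inside; at landing S44 is a FACE with no decided applier.  This file gives it one:
* §1 (any `d`) THE DATUM's FINE SIDE: `cL` = the CENTRE cube of block 0 of the fine torus (coordinates `⌊L∕2⌋`); **`tclosure_cL : tclosure L N′ {c_L} = {0}`** — the
  closure (collar ∘ block map) of the centre cube IS its block, BECAUSE its 3^d-neighbourhood stays inside the block when `3 ≤ L` (`tcoarse_eq_zero_of_mem_tblock_cL`:
  `⌊L∕2⌋ ± 1 ∈ [0, L−1]`, `Int.ediv_eq_zero_of_lt`, pv22 `tcoarse_proj`, S43.1 `natLift_proj_of_range`); interiority is NEEDED — the corner cube's collar LEAKS into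
  the next block (PART 2 `one_mem_tclosure_corner`, `tclosure_corner_ne`);
* §2 (d = 4) `CL : TDom 4 (L·N′)` (S47 `tFaceConnected_singleton`), **`tclosureDom_CL : tclosureDom L N′ C_L = X₀ N′`**, `torusTreeLen_CL = 0` — the component has TREE
  LENGTH 0, so S44's (2.36) transfer, DISCHARGED inside S44, is met on THIS datum as `ℓ·0 ≤ 0`: the toy is two-scale in the CLOSURE MAP, not in the transfer (a
  positive-length interior box, `L ≥ 5`, is a follower, not this row);
* §3 THE RATES in S44's literal numeral currency (`64·log 162`, `K₀(64,8)`), EVERY located clause MET WITH EQUALITY as a named lemma: `rN = 64 log 162 + 1` (`hκ_N_eq`,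
  `rfl`), `RN = 2·(64 log 162) + 3` (= W50's `RI`: `RN_eq_RI`), `vN = e^{−5R}∕64` (= W53's `vC`: `vN_eq_vC`; `hRR_N_eq`: `64·v·e^{5R} = 1`), the TRANSFER RATE
  `R₀N L := 64 log 162 + (r+R)·a236 L ∕ L` so that S44's `hrate2 : r + R ≤ (R₀ − 64 log 162)·(L∕a236 L)` holds WITH EQUALITY at pv22's factor `ℓ = L∕a236 L`
  (`hrate2_N_eq`; `a236 L = 3 + 4∕(L−2)` BY NAME), the amplitude `εN L := α₆F∕(3⁴·L⁴·K₀(64,8)·e^{5R})` so that S44's (2.29) clause WITH THE ANCHOR COUNT `3⁴L⁴`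
  holds WITH EQUALITY (`h229_N_eq`, `= 1`), `hsmall_N` (`= ½ ≤ 1` at W24's located `A`);
* §4 inner labels `ι₀ := Unit`, `mN Z₀ () := e^{−R₀·d_k(Z₀)}` — S44's displayed `hinner` (N0u's currency) MET WITH EQUALITY, CHOSEN (not supplied from N0u's inner
  count: that is S41's); the labels `LabelN` (typed over `TDom 4 N′` ∕ `TDom 4 (L·N′)` — S44's `(tsys …).Dom` spelling is met by definitional unfolding at the END),
  the covered label `⟨∅, ⟨{X₀}, X₀ ↦ ⟨C_L, ()⟩⟩⟩` and the uncovered label `⟨{0}, ⟨∅, –⟩⟩`, `termsN Z := if Z = X₀ N′ then {covered, uncovered} else ∅`,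
  **`hadm_N`** — S44's `hadm` incl. its third clause: `C_L` IS in the closure fibre of `X₀` by `tclosureDom_CL` (the covered family's membership by b13's
  `mem_coveringFamilies` + `Finset.singleton_biUnion`, the uncovered one by W50.1's `coveringFamilies_emptyFootprint` BY NAME);
* §5 cores: `majN` = S44's majorant VERBATIM (`majN_coveredN = εN`, `majN_uncoveredN = vN`), one W33 core `coreW (cN l) r` per label, `cN l := (cM r∕2)·majN l`,
  **`hAmp_N`** by W41's `budget_half` at `A₀ := 0`, `A₁ := A∕4`, `ϱ := 2`; the activity `actN` (`hact`∕`hscale` by `rfl`);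
* §6 **`nestedToriEnd_fires`** — S44's END ONCE BY NAME with `(hL : 3 ≤ L)`, `X₀ := X₀ N′`, `I := fun _ => univ`, `m := mN`, `bsel := (·).2.1.choose`,
  `(ε, c₀, R₀, r, R, c′, v) := (εN L, 0, R₀N L, rN, RN, 5, vN)`, W24's `hrate_torus_num`, W33's `ctr0`∕`hroom0`, NE5's toy letters `(1, 0, 1)` INLINE, and the (2.27)∘(2.37)
  LINK **`hlink := link_torus' 4 N′`** (S40.1 BY NAME — S44's `hlink` IS its shape); conclusion LITERAL (the crew's COARSE-torus currency); closed form `≤ K₀(64,8)`.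

WORDING OF RECORD (crew row W59 = DAG N29zzzi, typer R-T133 (ii) (a)–(e)): «a DECIDED applier of S44's END; TWO-SCALE in the closure map ONLY — the component is a
unit fine cube (tree length 0), the (2.36) transfer is met as `ℓ·0 ≤ 0`, a positive-length interior component (`L ≥ 5`) is a FOLLOWER; `hinner` CHOSEN, not N0u-supplied
(S41); (B3-amp) MET because the weights are CHOSEN as S44's majorant — UNPRINTED for Bałaban's cores (G-ne9p2-5); (B1b) NOT claimed; WHICH tori are Bałaban's
(𝐃_{k+1}, 𝐃_k) = pv22's READING (D-pv22.3)».

HONEST FRAMING.  A DECIDED TOY ([folklore] ∕ [decided toy] ∕ [arith] tags; 0 sorry; 0 citations — bracketed names are labels; no `def … : Prop` — the `def`s are toy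
DATA, five numerals and one type abbreviation).  The cores are THEOREM-backed instances of the cell's typed FORMAT of (2.14) (`B13TermParamGaussianBi.BiCore`) over row
NE5's TOY frame — NOT Bałaban's (2.14) terms; the centre cube, `ι₀ = Unit`, the two labels, the weights and the numerals `64 log 162 + 1`, `2·(64 log 162) + 3`,
`e^{−5R}∕64`, `64 log 162 + (r+R)·a236 L∕L`, `α₆F∕(3⁴L⁴K₀e^{5R})`, `A∕4` are OUR toy choices over pv22's located letters; the code's `5` is (2.27)'s typed constant via
S40.1 and N0v's displayed `(d+5)` shape, `3⁴·L⁴` is S44's anchor count; print's ½L, (L+2)⁴, «L an odd positive integer > 11» ([Balaban1987RGI] p.251), (1.28),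
(2.35)–(2.39) of [Balaban1988RGII] are TYPE∕CONTEXT only — no numeral of the audited manuscripts is asserted as a fact about Bałaban's densities; 0 binders
instantiated on Bałaban's densities; no wall item; wall v1.7 (T4-DAG v47) does NOT move; R-t4r2-Q2 NOT met thereby; NE1′ ⇐ the named binders — NOT proved, NOT
printed; spine PROVED 0∕9; count 9 unchanged.  ABSOLUTE RULE honoured (nothing internally minted is cited; `FlowStep.BetaPertH` ∕ (B) ∕ G-an2-4 in prose only).
Rung (B)+1 on ONE finite four-torus — NOT infinite volume, NOT a mass gap, NOT OS on ℝ⁴, NOT Clay.  HONEST DEPENDENCY: continuum YM on T⁴ ⇐ BetaPertH ∧ nine spine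
estimates (0/9 proved); BetaPertH ⇐ (D1) ∧ (D4) ∧ CAP+tail; G-an2-4 gates asym, D1 and NE2/3/4.
-/

noncomputable section

namespace Summit.QuantumFields.BalabanUV.T4Continuum.NE1p.DressedSmallFieldNestedToriWitness

open Set Metric MeasureTheory Complex
open scoped BigOperators
open Literature.MathematicalPhysics.QuantumFieldTheory.Balaban1983to89
open Literature.MathematicalPhysics.QuantumFieldTheory.Balaban1983to89.B12TreeDecay (K₀ K₀_pos)
open Literature.MathematicalPhysics.QuantumFieldTheory.Balaban1983to89.B13Resummation (locE)
open Literature.MathematicalPhysics.QuantumFieldTheory.Balaban1983to89.B13FamilySum (coveringFamilies mem_coveringFamilies)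
open Literature.MathematicalPhysics.QuantumFieldTheory.Balaban1983to89.B13ScaleTransfer (Pt block mem_block coarse)
open Literature.MathematicalPhysics.QuantumFieldTheory.Balaban1983to89.B13Geometry236 (a236 a236_pos)
open Literature.MathematicalPhysics.QuantumFieldTheory.Balaban1983to89.TreeLengthTorus (TPt TDom proj natLift proj_natLift tsys
  torusTreeLen torusTreeLen_singleton)
open Literature.MathematicalPhysics.QuantumFieldTheory.Balaban1983to89.TreeLengthTorusGeometry (tgeometry TTouch)
open Literature.MathematicalPhysics.QuantumFieldTheory.Balaban1983to89.TreeLengthTorusTransfer (tcoarse tcoarse_proj tblock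
  mem_tblock_self tcollar tclosure tclosureDom tclosureDom_val)
open Summit.QuantumFields.BalabanUV.T4Continuum.B13HistMeasurable (B13HistM)
open Summit.QuantumFields.BalabanUV.T4Continuum.B13HistWitness (toyFrame)
open Summit.QuantumFields.BalabanUV.T4Continuum.B13TermParamGaussianBi (BiCore)
open Summit.QuantumFields.BalabanUV.T4Continuum.TorusBlockRefinement (natLift_proj_of_range)
open Summit.QuantumFields.BalabanUV.T4Continuum.TorusBlockRefinementCard (tFaceConnected_singleton)
open Summit.QuantumFields.BalabanUV.T4Continuum.NE1p.DressedSmallFieldTorusWitness (X₀ X₀_val hrate_torus_num)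
open Summit.QuantumFields.BalabanUV.T4Continuum.NE1p.DressedSmallFieldGeometry (torus_consts)
open Summit.QuantumFields.BalabanUV.T4Continuum.NE1p.DressedSmallFieldCoresWitness (E1 liveTable norm_liveTable_le coreW N₁_coreW ctr0
  hroom0 Acst Acst_pos)
open Summit.QuantumFields.BalabanUV.T4Continuum.NE1p.DressedSmallFieldCoresMassWitness (letterMass_coreW cM cM_pos)
open Summit.QuantumFields.BalabanUV.T4Continuum.NE1p.DressedSmallFieldDepCoresWitness (budget_half)
open Summit.QuantumFields.BalabanUV.T4Continuum.NE1p.DressedSmallFieldFamiliesWitness (α₆F α₆F_pos)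
open Summit.QuantumFields.BalabanUV.T4Continuum.NE1p.DressedSmallFieldInnerLink (link_torus')
open Summit.QuantumFields.BalabanUV.T4Continuum.NE1p.DressedSmallFieldInnerLabelsWitness (RI coveringFamilies_emptyFootprint)
open Summit.QuantumFields.BalabanUV.T4Continuum.NE1p.DressedSmallFieldComponentsWitness (vC vC_pos vC_le c₁_mul_vC)
open Summit.QuantumFields.BalabanUV.T4Continuum.NE1p.DressedSmallFieldNestedTori
  (attachedPart_locE_le_of_coresAt_pencil_components_nestedTori)

/-! ## §1 THE DECIDED TWO-SCALE DATUM: the centre cube of a block of the FINE torus, and its closure on the COARSE torus -/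

section Closure
variable {d : ℕ} (L N' : ℕ) [NeZero L] [NeZero N']

/-- THE CENTRE CUBE OF BLOCK 0 of the fine torus (toy DATA): every coordinate `⌊L∕2⌋`. [folklore] -/
def cL : TPt d (L * N') := proj (L * N') fun _ => ((L / 2 : ℕ) : ℤ)

/-- Its standard lift is `(⌊L∕2⌋, …, ⌊L∕2⌋)` (S43.1 `natLift_proj_of_range`). [folklore] -/
theorem natLift_cL (hL : 3 ≤ L) : natLift (cL (d := d) L N') = fun _ => ((L / 2 : ℕ) : ℤ) := by
  unfold cL
  refine natLift_proj_of_range fun i => ⟨by positivity, ?_⟩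
  have hN : 1 ≤ N' := Nat.one_le_iff_ne_zero.2 (NeZero.ne N')
  have h : L / 2 < L * N' := lt_of_lt_of_le (Nat.div_lt_self (by omega) one_lt_two) (Nat.le_mul_of_pos_right L hN)
  exact_mod_cast h

/-- **EVERY CUBE OF THE CENTRE CUBE's 3^d-NEIGHBOURHOOD COARSENS TO BLOCK 0** (kernel; needs `3 ≤ L`: the neighbours' coordinates
`⌊L∕2⌋ ± 1` lie in `[0, L − 1]`, so `coarse L y = 0`; pv22's `tcoarse_proj`). [folklore] -/
theorem tcoarse_eq_zero_of_mem_tblock_cL (hL : 3 ≤ L) {a : TPt d (L * N')} (ha : a ∈ tblock (cL L N')) :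
    tcoarse L N' a = 0 := by
  unfold tblock at ha
  rw [natLift_cL L N' hL] at ha
  obtain ⟨y, hy, rfl⟩ := Finset.mem_image.1 ha
  rw [tcoarse_proj]
  have hy' := mem_block.1 hy
  have h1 : (1 : ℤ) ≤ ((L / 2 : ℕ) : ℤ) := by exact_mod_cast (show 1 ≤ L / 2 by omega)
  have h2 : ((L / 2 : ℕ) : ℤ) + 1 < (L : ℤ) := by exact_mod_cast (show L / 2 + 1 < L by omega)
  have hc : coarse L y = 0 := by
    funext i
    obtain ⟨hl, hu⟩ := hy' i
    exact Int.ediv_eq_zero_of_lt (by linarith) (by linarith)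
  rw [hc]
  funext i
  exact Int.cast_zero

/-- **THE CLOSURE OF THE CENTRE CUBE IS ITS BLOCK** (kernel, LOCATED): `tclosure L N′ {c_L} = {0}` — print's Z′ («the smallest
localization domain from 𝐃_{k+1} containing Z̃», pv22's `tclosure` = collar ∘ block map) of the one-cube fine domain at the centre of
block 0 is the ONE coarse block `0`, for every `3 ≤ L` and every `N′`. [folklore] -/
theorem tclosure_cL (hL : 3 ≤ L) : tclosure L N' ({cL L N'} : Finset (TPt d (L * N'))) = {0} := by
  unfold tclosure tcollar
  rw [Finset.singleton_biUnion]
  refine Finset.eq_singleton_iff_unique_mem.2 ⟨?_, fun b hb => ?_⟩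
  · exact Finset.mem_image.2 ⟨cL L N', mem_tblock_self _, tcoarse_eq_zero_of_mem_tblock_cL L N' hL (mem_tblock_self _)⟩
  · obtain ⟨a, ha, rfl⟩ := Finset.mem_image.1 hb
    exact tcoarse_eq_zero_of_mem_tblock_cL L N' hL ha

end Closure

/-! ## §2 THE DATUM AS TORUS DOMAINS (d = 4): the fine component `C_L`, its closure the coarse unit block `X₀ N′` -/

section Datum
variable (L N' : ℕ) [NeZero L] [NeZero N']

/-- THE COMPONENT (toy DATA): the one-cube FINE torus domain at the centre of block 0 (a `TDom 4 (L·N′)`; S47's `tFaceConnected_singleton`). [folklore] -/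
def CL : TDom 4 (L * N') := ⟨{cL L N'}, ⟨Finset.singleton_nonempty _, tFaceConnected_singleton _⟩⟩

/-- **THE CLOSURE OF THE COMPONENT IS THE COARSE UNIT BLOCK**: `tclosureDom L N′ C_L = X₀ N′` (pv22's `tclosureDom`, W24's `X₀`). [folklore] -/
theorem tclosureDom_CL (hL : 3 ≤ L) : tclosureDom L N' (CL L N') = X₀ N' :=
  Subtype.ext (by rw [tclosureDom_val]; exact tclosure_cL L N' hL)

/-- The component has tree length `0` (pv22 `torusTreeLen_singleton`): S44's (2.36) transfer is met HERE as `ℓ·0 ≤ 0` — two-scale in the CLOSURE MAP only. [folklore] -/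
theorem torusTreeLen_CL : torusTreeLen (CL L N').1 = 0 := torusTreeLen_singleton _

/-! ## §3 THE RATES, EVERY LOCATED CLAUSE OF S44 MET WITH EQUALITY (S44's literal numeral currency `64·log 162`, `K₀(64,8)`) -/

/-- The (2.29) rate `r := 64·log 162 + 1` (S44's `hκ` WITH EQUALITY; = W45's `δF·κF`). [folklore] -/
def rN : ℝ := 64 * Real.log 162 + 1
/-- The outer rate `R := 2·(64·log 162) + 3` — W50's `RI` in S44's numeral currency (`RN_eq_RI`). [folklore] -/
def RN : ℝ := 2 * (64 * Real.log 162) + 3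
/-- The uncovered-cube letter `v := e^{−5R}∕64` — my W53's `vC` in S44's currency (`vN_eq_vC`). [folklore] -/
def vN : ℝ := Real.exp (-(5 * RN)) / 64
/-- The inner rate WITH THE TRANSFER FACTOR: `R₀ := 64·log 162 + (r + R)·a236 L ∕ L`, so that S44's `hrate2 : r + R ≤ (R₀ − 64 log 162)·(L∕a236 L)`
holds WITH EQUALITY at pv22's (2.36) factor `ℓ = L ∕ a236 L` (`a236 L = 3 + 4∕(L−2)` BY NAME; ℓ = 3∕7 at L = 3, 143∕37 at L = 13). [folklore] -/
def R₀N : ℝ := 64 * Real.log 162 + (rN + RN) * (a236 (L : ℝ) / L)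
/-- The component amplitude WITH THE ANCHOR COUNT: `ε := α₆F ∕ (3⁴·L⁴·K₀(64,8)·e^{5R})`, so that S44's (2.29) clause
`e·K₀·64·(ε·e^{c₀}·(3⁴L⁴)·K₀·e^{5R}) ≤ 1` at `c₀ = 0` holds WITH EQUALITY (W45's `α₆F = (e·K₀(64,8)·64)⁻¹`). [folklore] -/
def εN : ℝ := α₆F / ((3 : ℝ) ^ 4 * (L : ℝ) ^ 4 * K₀ 64 8 * Real.exp (5 * RN))

/-- `R = RI` (W50's count rate, by `torus_consts`). [arith] -/
theorem RN_eq_RI : RN = RI N' := by unfold RN RI; rw [(torus_consts N').2.1]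
/-- `v = vC` (W53's letter). [arith] -/ theorem vN_eq_vC : vN = vC N' := by unfold vN vC; rw [RN_eq_RI N']
/-- `0 < v`. [arith] -/ theorem vN_pos : 0 < vN := by unfold vN; positivity
/-- `0 < ε`. [arith] -/
theorem εN_pos : 0 < εN L := by
  unfold εN; have := α₆F_pos; have := K₀_pos (64 : ℝ) 8; have : (0 : ℝ) < L := by exact_mod_cast Nat.pos_of_ne_zero (NeZero.ne L)
  positivity
/-- **S44's `hκ` WITH EQUALITY**: `64·log 162 + 1 = r`. [arith] -/
theorem hκ_N_eq : 64 * Real.log 162 + 1 = rN := rfl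
/-- **S44's `hRR` WITH EQUALITY**: `Rkp = 2·(64 log 162) + 2 = R − 64·(v·e^{R·5})` (`64·v·e^{5R} = 1` — my W53's `c₁_mul_vC` at `c₁ = 64`). [arith] -/
theorem hRR_N_eq : 2 * (64 * Real.log 162) + 2 = RN - 64 * (vN * Real.exp (RN * 5)) := by
  have h : 64 * (vN * Real.exp (RN * 5)) = 1 := by
    unfold vN; rw [show RN * 5 = 5 * RN by ring, div_mul_eq_mul_div, ← Real.exp_add, neg_add_cancel, Real.exp_zero]; norm_num
  rw [h]; unfold RN; ring
omit [NeZero L] in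
/-- **S44's `hrate2` WITH EQUALITY at pv22's transfer factor**: `r + R = (R₀ − 64 log 162)·(L ∕ a236 L)`. [arith] -/
theorem hrate2_N_eq (hL : 3 ≤ L) : rN + RN = (R₀N L - 64 * Real.log 162) * ((L : ℝ) / a236 L) := by
  have hL3 : (3 : ℝ) ≤ L := by exact_mod_cast hL
  have ha : 0 < a236 (L : ℝ) := a236_pos (by linarith)
  have hL0 : (0 : ℝ) < L := by linarith
  unfold R₀N
  field_simp
  ring
omit [NeZero L] in
/-- S44's `hκR`: `64·log 162 ≤ R₀` (the added transfer term is non-negative). [arith] -/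
theorem hκR_N (hL : 3 ≤ L) : 64 * Real.log 162 ≤ R₀N L := by
  have hL3 : (3 : ℝ) ≤ L := by exact_mod_cast hL
  have ha : 0 < a236 (L : ℝ) := a236_pos (by linarith)
  have hr : 0 ≤ rN + RN := by unfold rN RN; have := Real.log_nonneg (by norm_num : (1:ℝ) ≤ 162); positivity
  unfold R₀N
  have : 0 ≤ (rN + RN) * (a236 (L : ℝ) / L) := by positivity
  linarith
/-- **S44's (2.29) CLAUSE WITH THE ANCHOR COUNT, WITH EQUALITY**: `e·K₀·64·(ε·e^0·(3⁴L⁴)·K₀·e^{5R}) = e·K₀(64,8)·64·α₆F = 1`. [arith] -/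
theorem h229_N_eq : Real.exp 1 * K₀ 64 8 * 64 *
    (εN L * Real.exp 0 * ((3 : ℝ) ^ 4 * (L : ℝ) ^ 4) * K₀ 64 8 * Real.exp (5 * RN)) = 1 := by
  have hK := K₀_pos (64 : ℝ) 8
  have hL0 : (0 : ℝ) < L := by exact_mod_cast Nat.pos_of_ne_zero (NeZero.ne L)
  have he := Real.exp_pos (5 * RN)
  have he1 := Real.exp_pos 1
  unfold εN α₆F
  rw [Real.exp_zero]
  field_simp
/-- The «ε small» clause of the step at `A₀ = 0`, `ϱ = 2`, `A₁ = A∕4`, `r₁ = 0`: `(0 + 2·(A∕4))·e^{5·0+1}·K₀(64,8)·9·64 = ½ ≤ 1` (W24's located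
constant `A = (e·K₀(64,8)·9·64)⁻¹`). [arith] -/
theorem hsmall_N : (0 + 2 * (Acst / 4)) * Real.exp (5 * 0 + 1) * K₀ 64 8 * 9 * 64 ≤ 1 := by
  rw [show (5 : ℝ) * 0 + 1 = 1 by norm_num]
  unfold Acst
  have hK := K₀_pos (64 : ℝ) 8
  have he := Real.exp_pos 1
  rw [show (0 + 2 * ((Real.exp 1 * K₀ 64 8 * 9 * 64)⁻¹ / 4)) * Real.exp 1 * K₀ 64 8 * 9 * 64 =
    (1 / 2) * ((Real.exp 1 * K₀ 64 8 * 9 * 64)⁻¹ * (Real.exp 1 * K₀ 64 8 * 9 * 64)) by ring, inv_mul_cancel₀ (by positivity)]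
  norm_num

/-! ## §4 THE INNER DATA AND THE TERM INDEX (toy DATA): one inner label per component; TWO outer labels at the coarse unit block -/

/-- THE INNER WEIGHT OF A FINE COMPONENT (toy DATA): `m Z₀ () := e^{−R₀·d_k(Z₀)}` (N0u's currency at `c₀ = 0`; `hinner` WITH EQUALITY, CHOSEN —
not supplied from N0u: S41). [folklore] -/
def mN (Z₀ : (tsys 4 (L * N')).Dom) (_u : Unit) : ℝ := Real.exp (-(R₀N L * torusTreeLen Z₀.1))
/-- `0 ≤ m`. [arith] -/
theorem mN_nonneg : ∀ (Z₀ : (tsys 4 (L * N')).Dom) (u : Unit), 0 ≤ mN L N' Z₀ u := fun _ _ => (Real.exp_pos _).le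
/-- **S44's `hinner` WITH EQUALITY** over `I := univ : Finset Unit`. [arith] -/
theorem hinner_N_eq (Z₀ : (tsys 4 (L * N')).Dom) :
    ∑ u ∈ (Finset.univ : Finset Unit), mN L N' Z₀ u = Real.exp 0 * Real.exp (-(R₀N L * torusTreeLen Z₀.1)) := by
  rw [Finset.univ_unique, Finset.sum_singleton, Real.exp_zero, one_mul]; rfl
/-- At the component `C_L` the inner weight is `1` (tree length `0`). [arith] -/
theorem mN_CL (u : Unit) : mN L N' (CL L N') u = 1 := by
  unfold mN; rw [torusTreeLen_CL, mul_zero, neg_zero, Real.exp_zero]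

/-- S44's outer-label type with fine-component inner data: `⟨W′, ⟨F, p⟩⟩`, `p Z′ _ = ⟨Z₀, ()⟩` (a type abbreviation, no data). [folklore] -/
abbrev LabelN : Type := Σ _ : Finset (TPt 4 N'), Σ F : Finset (TDom 4 N'), ∀ Z ∈ F, (Σ _ : TDom 4 (L * N'), Unit)

/-- THE COVERED LABEL (toy DATA): nothing uncovered, the ONE family `{X₀}`, and for its member the component `C_L` of the FINE torus. [folklore] -/
def coveredN : LabelN L N' := ⟨∅, ⟨{X₀ N'}, fun _ _ => ⟨CL L N', ()⟩⟩⟩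
/-- THE UNCOVERED LABEL (toy DATA): the whole block uncovered, the empty family, the empty choice. [folklore] -/
def uncoveredN : LabelN L N' := ⟨{0}, ⟨∅, fun Z h => absurd h (Finset.notMem_empty Z)⟩⟩
/-- The two labels differ (first components `∅ ≠ {0}`). [folklore] -/
theorem coveredN_ne_uncoveredN : coveredN L N' ≠ uncoveredN L N' := fun h =>
  (Finset.singleton_ne_empty (0 : TPt 4 N')).symm (congrArg Sigma.fst h)

open Classical in
/-- THE TERM INDEX OF RECORD (toy DATA): at the coarse unit block the two labels above, nothing elsewhere. [folklore] -/
def termsN (Z : TDom 4 N') : Finset (LabelN L N') := if Z = X₀ N' then {coveredN L N', uncoveredN L N'} else ∅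

open Classical in
/-- The index at `X₀`. [folklore] -/
theorem termsN_X₀ : termsN L N' (X₀ N') = {coveredN L N', uncoveredN L N'} := if_pos rfl

open Classical in
/-- **S44's `hadm` MET**, third clause included: the component `C_L` IS in the closure fibre of `X₀` — `tclosureDom L N′ C_L = X₀ N′` (§2). [folklore] -/
theorem hadm_N (hL : 3 ≤ L) : ∀ Z : (tsys 4 N').Dom, ∀ l ∈ termsN L N' Z, l.1 ⊆ Z.1 ∧
    l.2.1 ∈ coveringFamilies Finset.univ (fun Y : (tsys 4 N').Dom => Y.1) (Z.1 \ l.1) ∧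
    ∀ Z' (h : Z' ∈ l.2.1), l.2.2 Z' h ∈
      ((Finset.univ : Finset (tsys 4 (L * N')).Dom).filter (fun Z₀ => tclosureDom L N' Z₀ = Z')).sigma (fun _ => (Finset.univ : Finset Unit)) := by
  intro Z l hl
  unfold termsN at hl
  split_ifs at hl with hZ
  · subst hZ
    rcases Finset.mem_insert.1 hl with rfl | hl'
    · refine ⟨Finset.empty_subset _, ?_, fun Z' h => ?_⟩
      · -- the ONE family `{X₀}` covers `{0} ∖ ∅ = {0}` (b13's `mem_coveringFamilies`; = W45's `coveringFamilies_unitCube` membership)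
        show ({X₀ N'} : Finset (TDom 4 N')) ∈ coveringFamilies Finset.univ (tgeometry 4 N').cubes ((X₀ N').1 \ ∅)
        rw [Finset.sdiff_empty]
        exact mem_coveringFamilies.2 ⟨Finset.subset_univ _, Finset.singleton_biUnion⟩
      · have hZ' : Z' = X₀ N' := Finset.mem_singleton.1 h
        subst hZ'
        exact Finset.mem_sigma.2 ⟨Finset.mem_filter.2 ⟨Finset.mem_univ _, tclosureDom_CL L N' hL⟩, Finset.mem_univ _⟩
    · rw [Finset.mem_singleton] at hl'
      subst hl'
      refine ⟨subset_rfl, ?_, fun Z' h => absurd h (Finset.notMem_empty Z')⟩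
      show (∅ : Finset (TDom 4 N')) ∈ coveringFamilies Finset.univ (tgeometry 4 N').cubes ((X₀ N').1 \ {0})
      rw [X₀_val, Finset.sdiff_self, coveringFamilies_emptyFootprint (tgeometry 4 N')]; exact Finset.mem_singleton_self _
  · exact absurd hl (Finset.notMem_empty l)

/-! ## §5 THE LABEL-INDEXED CORES (toy DATA): one W33 core per label, weighted by S44's majorant -/

/-- S44's table-blind majorant of a label (toy DATA): `v^{#W′}·Π_{x∈F.attach} ε·m (p x).1 (p x).2` — LITERALLY the shape in S44's `hAmp`. [folklore] -/
def majN (l : LabelN L N') : ℝ := vN ^ l.1.card * ∏ x ∈ l.2.1.attach, (εN L * mN L N' (l.2.2 x.1 x.2).1 (l.2.2 x.1 x.2).2)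
/-- `0 ≤ maj`. [arith] -/
theorem majN_nonneg (l : LabelN L N') : 0 ≤ majN L N' l :=
  mul_nonneg (pow_nonneg vN_pos.le _) (Finset.prod_nonneg fun _ _ => mul_nonneg (εN_pos L).le (mN_nonneg L N' _ _))
/-- **THE COVERED LABEL WEIGHS `ε`** (`#W′ = 0`, one member, the component of tree length `0`). [arith] -/
theorem majN_coveredN : majN L N' (coveredN L N') = εN L := by
  unfold majN coveredN
  rw [Finset.card_empty, pow_zero, one_mul,
    Finset.prod_attach {X₀ N'} (fun _ => εN L * mN L N' (CL L N') ()), Finset.prod_singleton, mN_CL, mul_one]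
/-- **THE UNCOVERED LABEL WEIGHS `v > 0`** (`#W′ = 1`, empty product). [arith] -/
theorem majN_uncoveredN : majN L N' (uncoveredN L N') = vN := by
  unfold majN uncoveredN
  rw [Finset.card_singleton, pow_one, Finset.attach_empty, Finset.prod_empty, mul_one]

variable (r : ℝ) (hr : 0 ≤ r)

/-- THE LABEL-DEPENDENT CAUCHY WEIGHT (toy DATA): `c l := (cM r∕2)·maj l` (W35's `cM` BY NAME). [folklore] -/
def cN (l : LabelN L N') : ℝ := cM r / 2 * majN L N' l

/-- **THE LABEL-INDEXED CORE FAMILY** (toy DATA): at the label `l` W33's one-label core `coreW` (BY NAME) at the weight `c l`. [folklore] -/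
def GN : ∀ (_ : ℕ) (_ : LabelN L N'), ℕ → BiCore toyFrame (fun _ : Unit => (0 : ℕ)) ℂ Unit E1 :=
  fun _ l _ => coreW (cN L N' r l) r hr
/-- The core at `(k, l, X)`. [folklore] -/
@[simp] theorem GN_apply (k : ℕ) (l : LabelN L N') (X : ℕ) : GN L N' r hr k l X = coreW (cN L N' r l) r hr := rfl

/-- THE ACTIVITY OF RECORD (toy DATA): the sum of the label-indexed cores' terms over the index, along the pencil `s ↦ 0 + s • liveTable`
(S44's `hact`∕`hscale` by `rfl`, `emb Z := k`). [folklore] -/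
def actN (k : ℕ) (s : ℂ) (Z : (tsys 4 N').Dom) : ℂ :=
  ∑ l ∈ termsN L N' Z, (GN L N' r hr k l k).termAt (0 : ℂ) ((0 : B13HistM toyFrame) + s • liveTable)

/-- **`hAmp` MET FOR EVERY SUB-POLYMER AND EVERY LABEL** [decided toy], in the LITERAL binder shape of S44 at NE5's toy letters `(1, 0, 1)`,
`ϱ = 2`, `A₀ = 0`, `A₁ = A∕4`: `maj l·|cM r∕2|·√(2π)·e^{r·2‖liveTable‖} ≤ (0 + 2·(A∕4))·maj l` (W35 `letterMass_coreW`, W41 `budget_half`). [folklore] -/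
theorem hAmp_N (k : ℕ) :
    ∀ Z : (tsys 4 N').Dom, Z.1 ⊆ (X₀ N').1 → ∀ l ∈ termsN L N' Z,
      (GN L N' r hr k l k).lam.real univ *
          ((GN L N' r hr k l k).wB * (fun (_ : ℕ) (_ : LabelN L N') (_ : ℕ) => (1 : ℝ)) k l k *
            Real.exp ((fun (_ : ℕ) (_ : LabelN L N') (_ : ℕ) => (0 : ℝ)) k l k)) *
          (Real.pi / ((fun (_ : ℕ) (_ : LabelN L N') (_ : ℕ) => (1 : ℝ)) k l k / 2)) ^ (Module.finrank ℝ E1 / 2 : ℝ) *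
        Real.exp ((GN L N' r hr k l k).N₁ * (‖(0 : B13HistM toyFrame)‖ + 2 * ‖liveTable‖)) ≤
      (0 + 2 * (Acst / 4)) * (vN ^ l.1.card * ∏ x ∈ l.2.1.attach, (εN L * mN L N' (l.2.2 x.1 x.2).1 (l.2.2 x.1 x.2).2)) := by
  intro Z _ l _
  simp only [GN_apply]
  rw [letterMass_coreW, N₁_coreW, norm_zero, zero_add]
  have hp : 0 ≤ majN L N' l := majN_nonneg L N' l
  have hT : 2 * ‖liveTable‖ ≤ 2 := by linarith [norm_liveTable_le]
  have hb := budget_half r hr hT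
  show |cN L N' r l| * Real.sqrt (2 * Real.pi) * Real.exp (r * (2 * ‖liveTable‖)) ≤ (0 + 2 * (Acst / 4)) * majN L N' l
  unfold cN
  rw [abs_mul, abs_of_nonneg hp]
  calc |cM r / 2| * majN L N' l * Real.sqrt (2 * Real.pi) * Real.exp (r * (2 * ‖liveTable‖))
      = majN L N' l * (|cM r / 2| * Real.sqrt (2 * Real.pi) * Real.exp (r * (2 * ‖liveTable‖))) := by ring
    _ ≤ majN L N' l * (Acst / 2) := mul_le_mul_of_nonneg_left hb hp
    _ = (0 + 2 * (Acst / 4)) * majN L N' l := by ring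

/-! ## §6 THE END FIRES: S44's nested-tori END applied ONCE BY NAME (a decided applier), for every `3 ≤ L` and every `N′` -/

open Classical in
/-- **S44's `attachedPart_locE_le_of_coresAt_pencil_components_nestedTori` FIRES** [decided toy]: the coarse torus `tsys 4 N′` and the FINE
torus `tsys 4 (L·N′)` (two different catalogues; S44's closure `tclosureDom L N′` between them, its (2.36) transfer and anchor inside), cores `GN`
indexed by the two labels, W33's `ctr0`∕`hroom0`, NE5's toy letters INLINE, the pencil's two radius inequalities, `hscale`∕`hact` by `rfl`, W24's
`hrate_torus_num`, `hsmall_N`, `I := univ : Finset Unit`, `m := mN`, `bsel := (·).2.1.choose`, `(ε, c₀, R₀, r, R, c′, v) := (εN, 0, R₀N, rN, RN, 5, vN)`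
with §3's equalities, **`hlink := link_torus' 4 N′`** (S40.1 BY NAME — S44's `hlink` is its literal shape), `hadm_N`, `hAmp_N`, `hϱ : 2 ≤ 2`, `hϱA`.
Conclusion LITERAL (the crew's coarse-torus currency at `A₁ = A∕4`, `r₁ = 0`). [folklore] -/
theorem nestedToriEnd_fires (hL : 3 ≤ L) (k : ℕ) :
    ‖locE (TTouch (d := 4) (N := N')) (fun Z : (tsys 4 N').Dom => Z.1) (actN L N' r hr k 1) (X₀ N').1 -
        locE (TTouch (d := 4) (N := N')) (fun Z : (tsys 4 N').Dom => Z.1) (actN L N' r hr k 0) (X₀ N').1‖ ≤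
      4 * (Real.exp 1 * 9 * 64 * K₀ 64 8 ^ 2) * (Acst / 4) * Real.exp (-(0 * torusTreeLen (X₀ N').1)) :=
  attachedPart_locE_le_of_coresAt_pencil_components_nestedTori hL (GN L N' r hr)
    (Win := Set.univ) (ctr := ctr0) (ROp := fun _ => 1) (RHist := fun _ => 2) (R' := fun _ => 2)
    (mq := fun _ _ _ => 1) (bq := fun _ _ _ => 0) (N₀ := fun _ _ _ => 1)
    hroom0 (fun _ _ _ _ _ _ _ => one_pos)
    (fun _ _ _ _ _ _ _ => ⟨fun _ _ => aestronglyMeasurable_const, fun _ => differentiableOn_const _, fun _ _ _ => by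
      show ‖(1 : ℂ)‖ ≤ 1; rw [norm_one]⟩)
    (fun _ _ _ _ _ _ _ => ⟨fun _ _ => (Complex.measurable_ofReal.comp (measurable_snd.norm.pow_const 2)).aestronglyMeasurable,
      fun _ _ => differentiableOn_const _, fun _ _ _ v => by
        show 1 * ‖v‖ ^ 2 - 0 ≤ (((‖v‖ ^ 2 : ℝ) : ℂ)).re; rw [Complex.ofReal_re]; simp⟩)
    (g := fun _ => 0) (Set.mem_univ _) (U := ()) (o := 0) (h₀ := 0) (w := liveTable) (ϱ := 2)
    (by show ‖(0 : ℂ) - 0‖ ≤ 1; simp)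
    (by show ‖(0 : B13HistM toyFrame) - 0‖ + 2 * ‖liveTable‖ ≤ 2; rw [sub_zero, norm_zero, zero_add];
        linarith [norm_liveTable_le])
    (emb := fun _ => k) (fun _ => rfl) (terms := termsN L N') (act := actN L N' r hr k) (fun _ _ _ => rfl)
    (A₀ := 0) (A₁ := Acst / 4) (r₁ := 0) (X₀ N')
    le_rfl (by have := Acst_pos; positivity) le_rfl hrate_torus_num hsmall_N
    (fun _ => (Finset.univ : Finset Unit)) (mN L N') (mN_nonneg L N') (fun Z' => Z'.2.1.choose) (fun Z' => Z'.2.1.choose_spec)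
    (ε := εN L) (c₀ := 0) (R₀ := R₀N L) (r := rN) (R := RN) (c' := 5) (v := vN)
    (εN_pos L).le vN_pos.le (fun Z₀ => (hinner_N_eq L N' Z₀).le) (hκR_N L hL) (hrate2_N_eq L hL).le hκ_N_eq.le (h229_N_eq L).le
    (link_torus' 4 N') hRR_N_eq.le (hadm_N L N' hL) (hAmp_N L N' r hr k) le_rfl (by have := Acst_pos; linarith)

open Classical in
/-- … in CLOSED FORM: `≤ 4·(e·9·64·K₀(64,8)²)·(A∕4) = K₀(64,8)`. [folklore] -/
theorem nestedToriEnd_fires_closed (hL : 3 ≤ L) (k : ℕ) :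
    ‖locE (TTouch (d := 4) (N := N')) (fun Z : (tsys 4 N').Dom => Z.1) (actN L N' r hr k 1) (X₀ N').1 -
        locE (TTouch (d := 4) (N := N')) (fun Z : (tsys 4 N').Dom => Z.1) (actN L N' r hr k 0) (X₀ N').1‖ ≤ K₀ 64 8 := by
  refine (nestedToriEnd_fires L N' r hr hL k).trans (le_of_eq ?_)
  rw [zero_mul, neg_zero, Real.exp_zero, mul_one]
  unfold Acst
  have hK := K₀_pos (64 : ℝ) 8
  have he := Real.exp_pos 1
  field_simp

end Datum

end Summit.QuantumFields.BalabanUV.T4Continuum.NE1p.DressedSmallFieldNestedToriWitness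

end
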